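import Literature.MathematicalPhysics.QuantumFieldTheory.Balaban1983to89.B9CubeBondRowAgreement
import Literature.MathematicalPhysics.QuantumFieldTheory.Balaban1983to89.B9CubeCutoffNearH
import Literature.MathematicalPhysics.QuantumFieldTheory.Balaban1983to89.B6Ineq2142KLevelV1L0

/-!
# `Balaban1983to89.B9CubeBondRowAgreementNearH` — THE STENCIL HYPOTHESES OF THE BOND-SECTOR ROW AGREEMENT DISCHARGED FROM `h^T_□(f₋) ≠ 0` ALONE:
# at every fine bond `f` whose source carries the cut-off of record `h^T_□`, EVERY index bond (of the member and of the cube sequence) whose averaging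
# stencil sees `f` has `NearH □` base points, hence `(Q*_□(U)a_□Q_□(U)A)(f) = (Q*(U)aQ(U)A)(f)` and
# `(Δ_{a,□}(U)A)(f) − (Δ_a(U)A)(f) = (D_U(R_□(U) − R(U))D*_UA)(f)` there — the bond-sector twin of `B9CubeCutoffNearH.nearH_of_hT`
# (sub-row G-B9-LETTERS, module M5.1c PART 2 (P2), completion; lead g29 RULING #5)

FRAMING (verbatim cell line):
statement-level skeleton of published theorems with citation tags; proofs where landed; nothing here is a claim about the Yang–Mills mass gap

Sources under audit (cell lit-balaban): T. Bałaban, *Propagators for lattice gauge theories in a background field*, Commun. Math. Phys. **99**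
(1985) 389–434 [`Balaban1985BackgroundPropagators`, "B9"], (3.87)–(3.88) p. 409, p. 409 l. 3–5, (3.105) p. 414 («Similarly for averaging
operators»), p. 408 («Ω_{j+1}(□) = □̃³ ∩ B^{j+1}(Λ_{j+1}). We take Ω_j(□) = □̃⁴», «Ω₀(□) ⊂ □̃⁵»); T. Bałaban, *Propagators and renormalization transformations for lattice
gauge theories. II*, Commun. Math. Phys. **96** (1984) 223–250 [`Balaban1984PropagatorsII`, "[4]"], (2.1)–(2.4) p. 224, (2.36) p. 229, (2.45)
p. 231; T. Bałaban, *… I*, Commun. Math. Phys. **95** (1984) 17–40 [`Balaban1984PropagatorsI`, "[3]"], (1.18) p. 20 («x(b) is a point in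
B^k(b₊)»).  Unit `lit-balaban-r05` (r05 gen 80).

## WHAT IS PRINTED AND WHAT IS SILENT

(3.105) p. 414 multiplies `Δ_a` against `h_□G_□h_□`, `supp h_□ ⊂ □̃`, and keeps ONLY the projection difference `DPD* − DP_□D*` between `Δ_a` and
`Δ_{a,□}`: on the bonds `h_□` sees, the averaging rows of the member and of the cube sequence are the same — the stencil of `(Q*aQ·)(f)` ([3] (1.18):
the double blocks `B^j(y) ∪ B^j(y + e_μ)` of the coarse bonds `y` averaging through `f`) stays inside `□̃³ ⊂ Ω_j(□) = □̃⁴` (p. 408).  Print is silent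
on this margin; this file is the margin, exactly, for the cell's cut-off `h^T_□` and hull `NearH □` of record.

## WHAT THIS FILE CERTIFIES (theorems only; kernel-checked)

§1 torus bookkeeping: `circAbs_le_of_torusSupNorm_lt` (a strict real bound on `|v|_T` is a per-coordinate integer bound), `radius_le_slack`
(`2·(2L^J − 1) + 1 ≤ (2L − 1)·S_j` for `J ≤ j + 2`, `M_h ≥ 3`), ★ `nearH_of_near_hT` — **THE SLACK OF THE HULL**: if `h^T_□(z) ≠ 0` and every
coordinate of `x` is within `ρ` of `z` on the torus with `2ρ + 1 ≤ (2L − 1)S_j`, then `NearH □ x` (`S_j + m_L·S_j + ρ ≤ widH`).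
§2 ★ `torusSupNorm_ends_lt` — **THE STENCIL REACH** ([3] (1.18)): a fine site of the double block of a coarse `j`-bond `b` is within torus distance
`2L^j` of BOTH base points `embIter j b.src`, `embIter j b.tgt` (r03's `torusSupNorm_lt_of_block_eq ∕ _shift`).
§3 at def-Y's index (`M_h ≥ 8`, `L ≥ 5`, `R ≥ 2L²`): `qK_apply'` ∕ `qKc_apply'` (the `Q`-entries ARE r03's weights `q_y(f)` of the member ∕ of the cube
sequence), `ends_of_qK_ne_zero` ∕ `ends_of_qKc_ne_zero` (a bond seen by `y` issues from the double block of `y`), `lvl_le_of_qK_ne_zero_of_hT` ∕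
`lvl_le_of_qKc_ne_zero_of_hT` (**the level window** `j(y) ≤ j(□) + 2` at `supp h^T_□`: `lev_ends_bounds` + `lev_le_of_near_suppT`),
★★ `nearH_ends_of_qK_ne_zero` ∕ `nearH_ends_of_qKc_ne_zero` — `h^T_□(f₋) ≠ 0`, `q_y(f) ≠ 0 ⟹ NearH □` of both base points of `y`.
§4 ★★ `rows_agree_of_hT` — the hypotheses `h1 ∧ h2` of `B9CubeBondRowAgreement.QsaQCubeY_apply_eq` from `h^T_□(f₋) ≠ 0`;
`QsaQCubeY_apply_eq_of_hT`; ★★ `deltaACubeY_sub_deltaAY_apply_eq_of_hT` — `(Δ_{a,□}(U)A)(f) − (Δ_a(U)A)(f) = (D_U(R_□(U) − R(U))D*_UA)(f)`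
whenever `h^T_□(f₋) ≠ 0`, for EVERY `U`, `parS`, `parB`, `Gp`, `A`; `cutoff_deltaACubeY_sub_deltaAY` — the same multiplied by `h^T_□(f₋)` at
every `f` (print's `h(b₋)` convention of (3.103)), with no hypothesis left.

## HONEST SCOPE

* Geometry of supports only; no inequality of the papers.  `h^T_□` is the cell's torus cut-off `B6Partition118KLevelTorus.hT` (the (2.36)-partition
  of record), `NearH` is `B9CubeSequence408.NearH`; the margin used is `(2L − 1)S_j ≥ 4L^{j+2}` (`M_h ≥ 3`; def-Y's index has `M_h ≥ 8`).
* Nothing is said about the size of `D_U(R_□ − R)D*_U` (print's third term of (3.105), estimated there by (3.49)).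
* Nothing is inferred from the manuscript; kernel-checked; 0 definitions, 0 facts.  NOT summit progress; the YM mass gap is not proved by any of this.
-/

namespace Literature.MathematicalPhysics.QuantumFieldTheory.Balaban1983to89.B9CubeBondRowAgreementNearH

open LatticeFieldCalculus
open Node00
open Literature.MathematicalPhysics.QuantumFieldTheory.Balaban1983to89.B4Reflection242 (boxDom)
open Literature.MathematicalPhysics.QuantumFieldTheory.Balaban1983to89.B4TorusKernel.MultiPeriod (torusSupNorm circAbs circAbs_le_abs circAbs_nonneg)
open Literature.MathematicalPhysics.QuantumFieldTheory.Balaban1983to89.B4Sect5Torus (circAbs_add_le)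
open Literature.MathematicalPhysics.QuantumFieldTheory.Balaban1983to89.B5Eq118OneStroke (iterBlockOf iterBlock mem_iterBlock)
open Literature.MathematicalPhysics.QuantumFieldTheory.Balaban1983to89.B6KLevelCensusIndexV1 (KIdx)
open Literature.MathematicalPhysics.QuantumFieldTheory.Balaban1983to89.B6MultiLevelBoxOperator (N0 bigSide)
open Literature.MathematicalPhysics.QuantumFieldTheory.Balaban1983to89.B6Cover236MultiLevelBlocks (cubes)
open Literature.MathematicalPhysics.QuantumFieldTheory.Balaban1983to89.B6Geom246MultiLevelBox (blkOf blkOf_val)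
open Literature.MathematicalPhysics.QuantumFieldTheory.Balaban1983to89.B6Geom246MultiLevelTorus (torusSupNorm_neg)
open Literature.MathematicalPhysics.QuantumFieldTheory.Balaban1983to89.B6Ineq2133TwoScaleV1 (onFun onFun_apply)
open Literature.MathematicalPhysics.QuantumFieldTheory.Balaban1983to89.B6GlobalChartV1 (PV domT toBox)
open Literature.MathematicalPhysics.QuantumFieldTheory.Balaban1983to89.B6MemberOfCubeV1 (torusSupNorm_lt_of_block_shift one_le_N0)
open Literature.MathematicalPhysics.QuantumFieldTheory.Balaban1983to89.B6Ineq2142KLevelV1 (torusSupNorm_lt_of_block_eq iterBlockOf_runSite_mem)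
open Literature.MathematicalPhysics.QuantumFieldTheory.Balaban1983to89.B6Partition118KLevelTorus (hT thetaT_ne_zero_of_hT_ne_zero)
open Literature.MathematicalPhysics.QuantumFieldTheory.Balaban1983to89.B6Partition118KLevelTorusBinders (lev_le_of_near_suppT)
open Literature.MathematicalPhysics.QuantumFieldTheory.Balaban1983to89.B6Cor28KLevelV1 (two_le_RMh)
open Literature.MathematicalPhysics.QuantumFieldTheory.Balaban1983to89.B15DeterminingSets (embIter)
open Literature.MathematicalPhysics.QuantumFieldTheory.Balaban1983to89.B9CubeSequence408 (sI hf mL widH ctrC ctrH NearH sI_pos two_mul_hf_add_one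
  two_mul_mL mL_nonneg abs_ctrC_sub_ctrH_le)
open Literature.MathematicalPhysics.QuantumFieldTheory.Balaban1983to89.B9CubeCutoffNearH (circAbs_le_of_thetaT_ne_zero)
open Literature.MathematicalPhysics.QuantumFieldTheory.Balaban1983to89.B9CubeBondWeights (domCube)
open Literature.MathematicalPhysics.QuantumFieldTheory.Balaban1983to89.B9CubeIndexBondsNearH (iterBlockOf_embIter')
open Literature.MathematicalPhysics.QuantumFieldTheory.Balaban1983to89.B9CubeLettersOpsL0 (oddMh cubeFamY levCubeY levCubeY_le_levY)
open Literature.MathematicalPhysics.QuantumFieldTheory.Balaban1983to89.B9CubeLettersBondOpsL0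
open Literature.MathematicalPhysics.QuantumFieldTheory.Balaban1983to89.B9CubeBondRowAgreement (rows_agree_of_nearH QsaQCubeY_apply_eq
  deltaACubeY_sub_deltaAY_apply_eq)
open scoped Matrix

noncomputable section

/-! ## §1 Torus bookkeeping: a strict sup-norm bound per coordinate, the radius slack, the hull near `supp h^T_□` -/

section Torus

variable {d ℓ Mh k R : ℕ} {P : Fin (d + 1) → ℕ} {D : B6MultiLevelTorusOperator.TDomains d ℓ Mh k P R}

/-- a strict real bound `|v|_T < n` on the torus sup-norm is the integer bound `≤ n − 1` on every coordinate's circular distance. [cite: Balaban1984PropagatorsI, p.17 l.30 (periodic lattice), bookkeeping] -/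
theorem circAbs_le_of_torusSupNorm_lt {N : Fin (d + 1) → ℕ} {v : Fin (d + 1) → ℤ} {n : ℕ}
    (h : torusSupNorm N v < ((n : ℕ) : ℝ)) (μ : Fin (d + 1)) : circAbs (N μ) (v μ) ≤ (n : ℤ) - 1 := by
  simp only [torusSupNorm, Finset.sup'_lt_iff] at h
  have hμ := h μ (Finset.mem_univ μ)
  have hcast : ((n : ℕ) : ℝ) = (((n : ℕ) : ℤ) : ℝ) := by push_cast; ring
  rw [hcast, Int.cast_lt] at hμ
  omega

/-- **THE RADIUS SLACK**: `2·(2L^J − 1) + 1 ≤ (2L − 1)·S_j` for `J ≤ j + 2`, `M_h ≥ 3` (`S_j = M_h·L^{j+1}`, `L = ℓ + 1 ≥ 2`). [cite: Balaban1985BackgroundPropagators, p.408 («M = KR₀M₀»), bookkeeping] -/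
theorem radius_le_slack (hℓ : 1 ≤ ℓ) (hMh : 3 ≤ Mh) {J j : ℕ} (hJ : J ≤ j + 2) :
    2 * (2 * ((ℓ : ℤ) + 1) ^ J - 1) + 1 ≤ (2 * (ℓ : ℤ) + 1) * sI ℓ Mh j := by
  have hL1 : (1 : ℤ) ≤ (ℓ : ℤ) + 1 := by linarith [(Nat.cast_nonneg ℓ : (0 : ℤ) ≤ ℓ)]
  have hX : (0 : ℤ) < ((ℓ : ℤ) + 1) ^ (j + 1) := by positivity
  have hpow : ((ℓ : ℤ) + 1) ^ J ≤ ((ℓ : ℤ) + 1) ^ (j + 2) := pow_le_pow_right₀ hL1 hJ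
  have hsI : sI ℓ Mh j = (Mh : ℤ) * ((ℓ : ℤ) + 1) ^ (j + 1) := by
    unfold sI bigSide; push_cast; ring
  rw [show ((ℓ : ℤ) + 1) ^ (j + 2) = ((ℓ : ℤ) + 1) * ((ℓ : ℤ) + 1) ^ (j + 1) by ring] at hpow
  rw [hsI]
  have hMh' : (3 : ℤ) ≤ (Mh : ℤ) := by exact_mod_cast hMh
  have hℓ' : (1 : ℤ) ≤ (ℓ : ℤ) := by exact_mod_cast hℓ
  nlinarith [mul_nonneg (sub_nonneg.2 hMh') hX.le, mul_nonneg (sub_nonneg.2 hℓ') hX.le]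

/-- ★ **THE SLACK OF THE HULL `NearH □` AROUND `supp h^T_□`**: if `h^T_□(z) ≠ 0` and every coordinate of `x` is within `ρ` of `z` (torus distance)
with `2ρ + 1 ≤ (2L − 1)·S_j`, then `x` is near □ (`|x_μ − ctrH_μ| ≤ ρ + S_j + m_L·S_j ≤ widH`).
[cite: Balaban1985BackgroundPropagators, (3.87)–(3.88) p.409, p.408 (□̃³ ⊂ Ω_j(□) = □̃⁴); Balaban1984PropagatorsII, (2.36) p.229] -/
theorem nearH_of_near_hT (hL : Odd (ℓ + 1)) (hM : Odd Mh) (hMh : 1 ≤ Mh) (hP : ∀ μ, 1 ≤ P μ) (q : ↥(cubes D.toDomains))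
    {z : ↥(boxDom (N0 ℓ Mh k P))} (hz : hT D q z ≠ 0) {x : Fin (d + 1) → ℤ} {ρ : ℤ}
    (hρ : 2 * ρ + 1 ≤ (2 * (ℓ : ℤ) + 1) * sI ℓ Mh q.1.1) (hx : ∀ μ, circAbs (N0 ℓ Mh k P μ) (x μ - z.1 μ) ≤ ρ) :
    NearH q x := by
  intro μ
  have hN : 1 ≤ N0 ℓ Mh k P μ := B6MultiLevelTorusOperator.one_le_N0 hMh hP μ
  have h1 := circAbs_le_of_thetaT_ne_zero hL hM hMh hP q (thetaT_ne_zero_of_hT_ne_zero D hz) μ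
  have h2 : circAbs (N0 ℓ Mh k P μ) (ctrC q μ - ctrH q μ) ≤ mL ℓ * sI ℓ Mh q.1.1 :=
    (circAbs_le_abs hN _).trans (abs_ctrC_sub_ctrH_le hL hM hMh q μ)
  have h3 := circAbs_add_le hN (x μ - z.1 μ) (z.1 μ - ctrC q μ)
  have h4 := circAbs_add_le hN (x μ - ctrC q μ) (ctrC q μ - ctrH q μ)
  rw [show x μ - z.1 μ + (z.1 μ - ctrC q μ) = x μ - ctrC q μ by ring] at h3
  rw [show x μ - ctrC q μ + (ctrC q μ - ctrH q μ) = x μ - ctrH q μ by ring] at h4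
  have e1 := two_mul_hf_add_one hL hM q.1.1
  have e2 := two_mul_mL (ℓ := ℓ) hL
  have e3 : 2 * (mL ℓ * sI ℓ Mh q.1.1) = (ℓ : ℤ) * sI ℓ Mh q.1.1 := by rw [← e2]; ring
  have e4 : 2 * ((ℓ : ℤ) * hf ℓ Mh q.1.1) = (ℓ : ℤ) * sI ℓ Mh q.1.1 - ℓ := by rw [← e1]; ring
  have hxμ := hx μ
  unfold widH
  linarith

end Torus

/-! ## §2 The stencil reach: a site of the double block of a coarse bond is within `2L^j` of both base points -/

section KIdxGeom

variable {d ℓ : ℕ} {hd : 1 ≤ d + 1} {hL : Odd (ℓ + 1) ∧ 1 < ℓ + 1} {b₀ b₁ : ℝ}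
variable (i : KIdx d ℓ hd hL b₀ b₁)

/-- ★ **THE STENCIL REACH** ([3] (1.18)): if the `j`-block of the fine site `s` is `b₋` or `b₊` for a coarse `j`-bond `b`, then `s` is within torus
sup-distance `2L^j` of the base points `embIter j b₋` AND `embIter j b₊`. [cite: Balaban1984PropagatorsI, (1.18) p.20 («x(b) is a point in B^k(b₊)»); Balaban1984PropagatorsII, (2.45) p.231] -/
theorem torusSupNorm_ends_lt {j : ℕ} (hj : j ≤ i.k) (b : PBond (PV d ℓ i.m i.K hd hL) j) {s : Site (PV d ℓ i.m i.K hd hL) 0}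
    (hs : iterBlockOf j s = b.src ∨ iterBlockOf j s = b.tgt) :
    torusSupNorm (N0 ℓ i.Mh i.k i.P') ((toBox i.hN (embIter j b.src)).1 - (toBox i.hN s).1) < 2 * (((ℓ + 1 : ℕ) : ℝ)) ^ j ∧
      torusSupNorm (N0 ℓ i.Mh i.k i.P') ((toBox i.hN (embIter j b.tgt)).1 - (toBox i.hN s).1) < 2 * (((ℓ + 1 : ℕ) : ℝ)) ^ j := by
  have hjm : j ≤ i.m + i.K := hj.trans i.hk
  have hN1 := one_le_N0 i.hN
  have hes : iterBlockOf j (embIter j b.src) = b.src := iterBlockOf_embIter' i j hjm b.src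
  have het : iterBlockOf j (embIter j b.tgt) = b.tgt := iterBlockOf_embIter' i j hjm b.tgt
  have hLj : (0 : ℝ) ≤ (((ℓ + 1 : ℕ) : ℝ)) ^ j := by positivity
  rcases hs with hss | hst
  · refine ⟨?_, ?_⟩
    · -- same block as the source base point
      have h := torusSupNorm_lt_of_block_eq i.hN hjm (x := embIter j b.src) (x' := s) (hss.trans hes.symm)
      linarith
    · -- the target block is the shift of the block of `s`
      have h' : iterBlockOf j (embIter j b.tgt) = (iterBlockOf j s).shift b.dir := by rw [het, hss]; rfl
      have h := torusSupNorm_lt_of_block_shift i.hN hjm h'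
      rwa [← neg_sub, torusSupNorm_neg hN1] at h
  · refine ⟨?_, ?_⟩
    · -- the block of `s` is the shift of the source block
      have h' : iterBlockOf j s = (iterBlockOf j (embIter j b.src)).shift b.dir := by rw [hes, hst]; rfl
      exact torusSupNorm_lt_of_block_shift i.hN hjm h'
    · have h := torusSupNorm_lt_of_block_eq i.hN hjm (x := embIter j b.tgt) (x' := s) (hst.trans het.symm)
      linarith

end KIdxGeom

/-! ## §3 At def-Y's index: the `Q`-entries are the weights, the double block, the level window, `NearH` of the base points -/

section Letters

variable {d ℓ : ℕ} {hd : 1 ≤ d + 1} {hL : Odd (ℓ + 1) ∧ 1 < ℓ + 1} {b₀ b₁ : ℝ}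
variable {𝔸 : Type} [NormedRing 𝔸] [NormedAlgebra ℂ 𝔸] [CompleteSpace 𝔸]
variable (i : KIdx d ℓ hd hL b₀ b₁) (q : ↥(cubes (toKT i).D.toDomains))

/-- side conditions of def-Y's index used below: `1 ≤ ℓ`, `2 ≤ M_h`, `3 ≤ M_h`, `2L ≤ R`, `2 ≤ R·M_h`. [cite: Balaban1984PropagatorsII, (2.1) p.224, bookkeeping] -/
theorem side_conds : 1 ≤ ℓ ∧ 2 ≤ i.Mh ∧ 3 ≤ i.Mh ∧ 2 * (ℓ + 1) ≤ i.R ∧ 2 ≤ i.R * i.Mh := by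
  refine ⟨le_trans (by norm_num) i.hℓ, le_trans (by norm_num) i.hM8, le_trans (by norm_num) i.hM8, ?_, two_le_RMh i.hR2 i.hM8⟩
  exact le_trans (Nat.mul_le_mul_left 2 (Nat.le_self_pow (by norm_num) (ℓ + 1))) i.hR2

/-- the member's `Q`-entry IS r03's weight `q_y(f)`. [cite: Balaban1984PropagatorsI, (1.18) p.20; Balaban1984PropagatorsII, (2.20) p.226, bookkeeping] -/
theorem qK_apply' (ι : IBondY i) (f : FBondY i) : qK i ι f = B6Ineq2142KLevelV1.qwt i.hN i.D i.hk ι f := by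
  rw [qK, LinearMap.toMatrix'_apply, onFun_apply]
  rfl

/-- the cube sequence's `Q`-entry IS r03's (level-0-admitting) weight of the cube family. [cite: Balaban1984PropagatorsI, (1.18) p.20; Balaban1985BackgroundPropagators, p.409 l.3–5, bookkeeping] -/
theorem qKc_apply' (ι : IBondCubeY i q) (f : FBondY i) : qKc i q ι f = B6Ineq2142KLevelV1L0.qwt i.hN (cubeFamY i q) i.hk ι f := by
  rw [qKc, LinearMap.toMatrix'_apply, onFun_apply]
  rfl

/-- a fine bond seen by the member's index bond `y` issues from the double block `B^j(y₋) ∪ B^j(y₊)`. [cite: Balaban1984PropagatorsI, (1.18) p.20] -/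
theorem ends_of_qK_ne_zero {ι : IBondY i} {f : FBondY i} (h : qK i ι f ≠ 0) :
    iterBlockOf (ι.1.1 : ℕ) f.src = ι.1.2.src ∨ iterBlockOf (ι.1.1 : ℕ) f.src = ι.1.2.tgt := by
  rw [qK_apply'] at h
  obtain ⟨x, hx, t, ht, rfl⟩ := B6Ineq2142KLevelV1.exists_of_qwt_ne_zero i.hN i.D i.hk ι h
  rw [mem_iterBlock] at hx
  have hjm : (ι.1.1 : ℕ) ≤ i.m + i.K := (Nat.lt_succ_iff.1 ι.1.1.2).trans i.hk
  change iterBlockOf _ (runSite x ι.1.2.dir t) = _ ∨ iterBlockOf _ (runSite x ι.1.2.dir t) = _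
  rcases iterBlockOf_runSite_mem hjm x ι.1.2.dir ht.le with h' | h'
  · exact Or.inl (h'.trans hx)
  · right; rw [h', hx]; rfl

/-- a fine bond seen by an index bond of the cube sequence issues from its double block. [cite: Balaban1984PropagatorsI, (1.18) p.20; Balaban1985BackgroundPropagators, p.409 l.3–5] -/
theorem ends_of_qKc_ne_zero {ι : IBondCubeY i q} {f : FBondY i} (h : qKc i q ι f ≠ 0) :
    iterBlockOf (ι.1.1 : ℕ) f.src = ι.1.2.src ∨ iterBlockOf (ι.1.1 : ℕ) f.src = ι.1.2.tgt := by
  rw [qKc_apply'] at h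
  obtain ⟨x, hx, t, ht, rfl⟩ := B6Ineq2142KLevelV1L0.exists_of_qwt_ne_zero i.hN (cubeFamY i q) i.hk ι h
  rw [mem_iterBlock] at hx
  have hjm : (ι.1.1 : ℕ) ≤ i.m + i.K := (Nat.lt_succ_iff.1 ι.1.1.2).trans i.hk
  change iterBlockOf _ (runSite x ι.1.2.dir t) = _ ∨ iterBlockOf _ (runSite x ι.1.2.dir t) = _
  rcases iterBlockOf_runSite_mem hjm x ι.1.2.dir ht.le with h' | h'
  · exact Or.inl (h'.trans hx)
  · right; rw [h', hx]; rfl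

/-- **AT `supp h^T_□` THE TORUS LEVEL IS `≤ j(□) + 1`.** [cite: Balaban1984PropagatorsII, (2.2) p.224, p.235; Balaban1985BackgroundPropagators, p.408] -/
theorem levY_le_of_hT_ne_zero {z : SiteY i} (hz : hT (toKT i).D q z ≠ 0) : levY i z ≤ q.1.1 + 1 := by
  obtain ⟨hℓ, hMh2, -, hR, -⟩ := side_conds i
  have h0 : torusSupNorm (N0 ℓ (toKT i).Mh (toKT i).k (toKT i).P) (z.1 - z.1) ≤ 1 := by
    rw [sub_self]
    simp only [torusSupNorm, Finset.sup'_le_iff]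
    intro ν _
    simp [circAbs]
  have h := lev_le_of_near_suppT hℓ hMh2 hR i.hP5 q hz h0
  rwa [blkOf_val] at h

/-- **THE LEVEL WINDOW (member)**: `h^T_□(f₋) ≠ 0` and `q_y(f) ≠ 0 ⟹ j(y) ≤ j(□) + 2`. [cite: Balaban1984PropagatorsII, (2.2)–(2.4) p.224; Balaban1985BackgroundPropagators, p.408, (3.89) p.409 («y, y′ ∈ □ ∈ 𝒟_j»)] -/
theorem lvl_le_of_qK_ne_zero_of_hT {ι : IBondY i} {f : FBondY i} (hf : hT (toKT i).D q (toBox i.hN f.src) ≠ 0) (h : qK i ι f ≠ 0) :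
    (ι.1.1 : ℕ) ≤ q.1.1 + 2 := by
  obtain ⟨-, -, -, -, hRM⟩ := side_conds i
  have h1 := (B6Ineq2142KLevelV1.lev_ends_bounds i.hN i.D i.hk (le_trans one_le_two i.hk2) hRM ι (ends_of_qK_ne_zero i h)).1
  have h2 := levY_le_of_hT_ne_zero i q hf
  change (ι.1.1 : ℕ) - 1 ≤ levY i (toBox i.hN f.src) at h1
  omega

/-- **THE LEVEL WINDOW (cube sequence)**: `h^T_□(f₋) ≠ 0` and `q^□_y(f) ≠ 0 ⟹ j(y) ≤ j(□) + 2` (`lev_□ ≤ lev`). [cite: Balaban1984PropagatorsII, (2.2)–(2.4) p.224; Balaban1985BackgroundPropagators, p.408] -/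
theorem lvl_le_of_qKc_ne_zero_of_hT {ι : IBondCubeY i q} {f : FBondY i} (hf : hT (toKT i).D q (toBox i.hN f.src) ≠ 0) (h : qKc i q ι f ≠ 0) :
    (ι.1.1 : ℕ) ≤ q.1.1 + 2 := by
  obtain ⟨-, -, -, -, hRM⟩ := side_conds i
  have h1 := (B6Ineq2142KLevelV1L0.lev_ends_bounds i.hN (cubeFamY i q) i.hk hRM ι (ends_of_qKc_ne_zero i q h)).1
  have h2 := levY_le_of_hT_ne_zero i q hf
  have h3 := levCubeY_le_levY i q (toBox i.hN f.src)
  change (ι.1.1 : ℕ) - 1 ≤ levCubeY i q (toBox i.hN f.src) at h1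
  omega

/-- the geometric core at level `J ≤ j(□) + 2`: a site of the double block of a coarse `J`-bond `b` with `h^T_□ ≠ 0` puts both base points of `b` in `NearH □`.
[cite: Balaban1985BackgroundPropagators, p.408 (□̃³ ⊂ □̃⁴), (3.87)–(3.88) p.409; Balaban1984PropagatorsI, (1.18) p.20] -/
theorem nearH_ends_of_double_block {J : ℕ} (hJk : J ≤ i.k) (hJ : J ≤ q.1.1 + 2) (b : PBond (PV d ℓ i.m i.K hd hL) J)
    {s : Site (PV d ℓ i.m i.K hd hL) 0} (hs : iterBlockOf J s = b.src ∨ iterBlockOf J s = b.tgt) (hf : hT (toKT i).D q (toBox i.hN s) ≠ 0) :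
    NearH q (toBox i.hN (embIter J b.src)).1 ∧ NearH q (toBox i.hN (embIter J b.tgt)).1 := by
  obtain ⟨hℓ, -, hMh3, -, -⟩ := side_conds i
  obtain ⟨h1, h2⟩ := torusSupNorm_ends_lt i hJk b hs
  have hcast : (2 : ℝ) * (((ℓ + 1 : ℕ) : ℝ)) ^ J = (((2 * (ℓ + 1) ^ J : ℕ)) : ℝ) := by push_cast; ring
  rw [hcast] at h1 h2
  have hρ : 2 * (((2 * (ℓ + 1) ^ J : ℕ) : ℤ) - 1) + 1 ≤ (2 * (ℓ : ℤ) + 1) * sI ℓ (toKT i).Mh q.1.1 := by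
    have h := radius_le_slack hℓ hMh3 (j := q.1.1) hJ
    push_cast at h ⊢
    exact h
  exact ⟨nearH_of_near_hT hL.1 (oddMh i) (toKT i).hMh (toKT i).hP q hf hρ (fun μ => circAbs_le_of_torusSupNorm_lt h1 μ),
    nearH_of_near_hT hL.1 (oddMh i) (toKT i).hMh (toKT i).hP q hf hρ (fun μ => circAbs_le_of_torusSupNorm_lt h2 μ)⟩

/-- ★★ **member**: `h^T_□(f₋) ≠ 0` and `(QA)` of the index bond `y` sees `f` ⟹ both base points of `y` are near □.
[cite: Balaban1985BackgroundPropagators, (3.105) p.414 («Similarly for averaging operators»), p.408; Balaban1984PropagatorsI, (1.18) p.20] -/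
theorem nearH_ends_of_qK_ne_zero {f : FBondY i} (hf : hT (toKT i).D q (toBox i.hN f.src) ≠ 0) (ι : IBondY i) (h : qK i ι f ≠ 0) :
    NearH q (toBox i.hN (embIter (ι.1.1 : ℕ) ι.1.2.src)).1 ∧ NearH q (toBox i.hN (embIter (ι.1.1 : ℕ) ι.1.2.tgt)).1 :=
  nearH_ends_of_double_block i q (Nat.lt_succ_iff.1 ι.1.1.2) (lvl_le_of_qK_ne_zero_of_hT i q hf h) ι.1.2 (ends_of_qK_ne_zero i h) hf

/-- ★★ **cube sequence**: `h^T_□(f₋) ≠ 0` and `(Q_□A)` of the index bond `y` sees `f` ⟹ both base points of `y` are near □.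
[cite: Balaban1985BackgroundPropagators, p.409 l.3–5, (3.105) p.414, p.408; Balaban1984PropagatorsI, (1.18) p.20] -/
theorem nearH_ends_of_qKc_ne_zero {f : FBondY i} (hf : hT (toKT i).D q (toBox i.hN f.src) ≠ 0) (ι : IBondCubeY i q) (h : qKc i q ι f ≠ 0) :
    NearH q (toBox i.hN (embIter (ι.1.1 : ℕ) ι.1.2.src)).1 ∧ NearH q (toBox i.hN (embIter (ι.1.1 : ℕ) ι.1.2.tgt)).1 :=
  nearH_ends_of_double_block i q (Nat.lt_succ_iff.1 ι.1.1.2) (lvl_le_of_qKc_ne_zero_of_hT i q hf h) ι.1.2 (ends_of_qKc_ne_zero i q h) hf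

/-! ## §4 The row agreement and the split of `Δ_{a,□}(U) − Δ_a(U)` at the bonds of `supp h^T_□` -/

/-- ★★ **THE STENCIL HYPOTHESES FROM `h^T_□(f₋) ≠ 0`**: every index bond of the cube sequence seeing `f` is an index bond of the member, and conversely.
[cite: Balaban1985BackgroundPropagators, p.409 l.3–5, (3.105) p.414; Balaban1984PropagatorsII, (2.3) p.224] -/
theorem rows_agree_of_hT (f : FBondY i) (hf : hT (toKT i).D q (toBox i.hN f.src) ≠ 0) :
    (∀ ι : IBondCubeY i q, qKc i q ι f ≠ 0 → (domT i.hN i.D i.hk).LamBond (ι.1.1 : ℕ) ι.1.2) ∧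
      (∀ ι : IBondY i, qK i ι f ≠ 0 → (domCube i q).LamBond (ι.1.1 : ℕ) ι.1.2) :=
  rows_agree_of_nearH i q f (fun ι h => nearH_ends_of_qKc_ne_zero i q hf ι h) (fun ι h => nearH_ends_of_qK_ne_zero i q hf ι h)

/-- ★ **THE ROW AGREEMENT AT THE BONDS OF `supp h^T_□`**: `(Q*_□(U)a_□Q_□(U)A)(f) = (Q*(U)aQ(U)A)(f)` whenever `h^T_□(f₋) ≠ 0` — every `U`, `parB`, `A`.
[cite: Balaban1985BackgroundPropagators, (3.105) p.414 («Similarly for averaging operators»), p.409 l.3–5; Balaban1984PropagatorsII, (2.20) p.226] -/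
theorem QsaQCubeY_apply_eq_of_hT (parB : BondParY 𝔸 i) (U : CfgY 𝔸 i) (A : FBondY i → 𝔸) (f : FBondY i)
    (hf : hT (toKT i).D q (toBox i.hN f.src) ≠ 0) :
    QsCubeY i q parB U (aCubeY i q (QCubeY i q parB U A)) f = QsY i parB U (aY i (QY i parB U A)) f :=
  QsaQCubeY_apply_eq i q parB U A f (rows_agree_of_hT i q f hf).1 (rows_agree_of_hT i q f hf).2

/-- ★★ **THE SPLIT AT THE BONDS OF `supp h^T_□`**: `(Δ_{a,□}(U)A)(f) − (Δ_a(U)A)(f) = (D_U((R_□(U) − R(U))D*_UA))(f)` whenever `h^T_□(f₋) ≠ 0` —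
print's `DPD* − DP_□D*` term of (3.105) and nothing else; every `U`, `parS`, `parB`, site slot `Gp`, `A`.
[cite: Balaban1985BackgroundPropagators, (3.105) p.414, (3.26) p.395, p.409 l.3–5; Balaban1984PropagatorsII, (2.16)–(2.19) pp.225–226] -/
theorem deltaACubeY_sub_deltaAY_apply_eq_of_hT (parS : SiteParY 𝔸 i) (parB : BondParY 𝔸 i) (Gp : SiteOpY 𝔸 i) (U : CfgY 𝔸 i)
    (A : FBondY i → 𝔸) (f : FBondY i) (hf : hT (toKT i).D q (toBox i.hN f.src) ≠ 0) :
    deltaACubeY i q parS parB U A f - deltaAY i parS parB Gp U A f =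
      gradY i U ((RCubeY i q parS U - RY i parS Gp U) (divY i U A)) f :=
  deltaACubeY_sub_deltaAY_apply_eq i q parS parB Gp U A f (rows_agree_of_hT i q f hf).1 (rows_agree_of_hT i q f hf).2

/-- **THE CUT-OFF FORM, NO HYPOTHESIS LEFT** (print's `h(b₋)` convention of (3.103)): at every fine bond `f`,
`h^T_□(f₋)·((Δ_{a,□}(U)A)(f) − (Δ_a(U)A)(f)) = h^T_□(f₋)·(D_U((R_□(U) − R(U))D*_UA))(f)`.
[cite: Balaban1985BackgroundPropagators, (3.103)–(3.105) p.414, p.409 l.3–5] -/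
theorem cutoff_deltaACubeY_sub_deltaAY (parS : SiteParY 𝔸 i) (parB : BondParY 𝔸 i) (Gp : SiteOpY 𝔸 i) (U : CfgY 𝔸 i)
    (A : FBondY i → 𝔸) (f : FBondY i) :
    ((hT (toKT i).D q (toBox i.hN f.src) : ℝ) : ℂ) • (deltaACubeY i q parS parB U A f - deltaAY i parS parB Gp U A f) =
      ((hT (toKT i).D q (toBox i.hN f.src) : ℝ) : ℂ) • gradY i U ((RCubeY i q parS U - RY i parS Gp U) (divY i U A)) f := by
  by_cases hf : hT (toKT i).D q (toBox i.hN f.src) = 0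
  · rw [hf]; simp
  · rw [deltaACubeY_sub_deltaAY_apply_eq_of_hT i q parS parB Gp U A f hf]

end Letters

end

end Literature.MathematicalPhysics.QuantumFieldTheory.Balaban1983to89.B9CubeBondRowAgreementNearH
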